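import Summits.QuantumFields.YangMills.Theorems.MarkovAtomsOnsetFloorMarkovTailPrelims
import Summits.QuantumFields.YangMills.Theorems.BalabanLadderInfVolRPSquare
import HarnessLib

/-!
# Cruxes `OnsetSkewLaw.RPOnsetFloor` (stmt-QuantumFields-23138) and `MarkovAtoms.OnsetFloor` (stmt-QuantumFields-22956), shared stub
# `stub_coarseCollarAtomRPFloor`: atom lemmas for the S3–S8 assembly (part 1 of `OnsetSkewLawRPOnsetFloorCoarseCollar.lean`)

Lemmas about the `b`-atoms `F_y = Σ'_x b(s(x + o_q) − y)·P_q(x)` of a compactly supported positive-time profile `b`, used by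
`RPOnsetFloorCoarseCollar.coarseCollar_of_crossFloor`: a positive-time profile puts every weighted plaquette at a base of height `≥ 0`
(`base_nonneg_of_weight_ne_zero`), so the atom lives in the RP cone `DependsOn · (siteHalfEdges 0)` (`atom_dependsOn`); the mirror
law `F_y ∘ Θ_cfg = F_{y_m}` for time-symmetric profiles (`atom_comp_cfgReflect`; tree `InfVolRP.plane_cfgReflect`,
`InfVolRP.smul_reflSite_add_of_centre`, `MarkovAtomsOnsetFloorMarkovTail.mirror_weight`); a bound on atoms that is UNIFORM over
spacings `s ≥ s₀` (`abs_atom_le`, from `MarkovAtomsOnsetFloorMarkovTail.abs_bumpAtom_le` and the site count `(⌈R₀/s₀⌉₊+1)⁴`);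
covariances of bounded observables (`abs_covariance_le`); and the REAL form of GaugeBoot's complex site-RP on the cone (`rp_real`).

HONEST FRAMING: bookkeeping; no stub / crux / rung / summit is proved; the Yang–Mills mass gap is NOT proved.  Cell `ym-idea-1`,
width seat `ym-line-sfw-p2-w5` g16 (free hands), on planner ym-idea-11 g13's GO (cell STATUS 2026-08-29T04:23:44Z).
References: K. Osterwalder, E. Seiler, Ann. Phys. 110 (1978) 440, §2 [OsterwalderSeiler1978]. [folklore]
-/

set_option autoImplicit false

noncomputable section

open scoped BigOperators
open MeasureTheory ProbabilityTheory Filter Topology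
open Literature.MathematicalPhysics.QuantumFieldTheory Literature.MathematicalPhysics.QuantumLattice
open Literature.Probability.LatticeModels (Site)
open Summit.QuantumFields.YangMills.Cruxes.OSLegsFromFemtoAndGap.DlrCollarTransfer (plane continuous_plane)
open Summit.QuantumFields.GaugeBoot (configSiteReflect siteHalfEdges IsReflectionPositiveFor)
open Summit.QuantumFields.YangMills.Theorems.InfVolRP (reflSite reflSite_reflSite plane_cfgReflect
  smul_reflSite_add_of_centre centreOffset two_mul_centreOffset_zero centreOffset_time configSiteReflect_zero_eq_cfgReflect
  dependsOn_plane)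
open Summit.QuantumFields.YangMills.Theorems.MarkovAtomsOnsetFloorMarkovTail (mirrorOffset mirror_weight atomSites
  abs_bumpAtom_le)

namespace Summit.QuantumFields.YangMills.Theorems.RPOnsetFloorCoarseCollar


/-! ## §1 Atom lemmas -/

section Atoms

variable {G : Type} [Group G] [TopologicalSpace G] [IsTopologicalGroup G] [CompactSpace G]
  [MeasurableSpace G] [BorelSpace G]

/-- A positive-time profile puts every weighted plaquette at a base site of height `≥ 0` (offset height `≥ 0`). [folklore] -/
theorem base_nonneg_of_weight_ne_zero {b : EuclideanSpace ℝ (Fin 4) → ℝ}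
    (hbpos : tsupport b ⊆ {u : EuclideanSpace ℝ (Fin 4) | 0 < u 0}) {s : ℝ} (hs : 0 < s) (q : Fin 4 × Fin 4)
    {y : EuclideanSpace ℝ (Fin 4)} (hy : 0 ≤ y 0) {x : Fin 4 → ℤ}
    (hx : b (s • (siteToE x + centreOffset q) - y) ≠ 0) : 0 ≤ x 0 := by
  have hmem : s • (siteToE x + centreOffset q) - y ∈ {u : EuclideanSpace ℝ (Fin 4) | 0 < u 0} :=
    hbpos (subset_tsupport _ hx)
  simp only [Set.mem_setOf_eq, PiLp.sub_apply, PiLp.smul_apply, PiLp.add_apply, siteToE_apply, smul_eq_mul] at hmem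
  have ho := centreOffset_time q
  by_contra hneg
  push Not at hneg
  have h1 : (x 0 : ℝ) ≤ -1 := by exact_mod_cast (show x 0 ≤ -1 by omega)
  have h2 : (x 0 : ℝ) + centreOffset q 0 < 0 := by linarith [ho.2]
  have h3 : s * ((x 0 : ℝ) + centreOffset q 0) < 0 := mul_neg_of_pos_of_neg hs h2
  linarith

omit [IsTopologicalGroup G] [CompactSpace G] [BorelSpace G] in
/-- **Atoms of positive-time profiles live in the positive-time cone** `DependsOn · (siteHalfEdges 0)`. [folklore] -/
theorem atom_dependsOn (r : LatticeRep G) {b : EuclideanSpace ℝ (Fin 4) → ℝ}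
    (hbpos : tsupport b ⊆ {u : EuclideanSpace ℝ (Fin 4) | 0 < u 0}) {s : ℝ} (hs : 0 < s) (q : Fin 4 × Fin 4)
    {y : EuclideanSpace ℝ (Fin 4)} (hy : 0 ≤ y 0) :
    DependsOn (fun U : LGConfig 4 G => ∑' x : Fin 4 → ℤ, b (s • (siteToE x + centreOffset q) - y) * plane G r q x U)
      (siteHalfEdges (d := 4) 0) := by
  intro U V hUV
  refine tsum_congr fun x => ?_
  by_cases hw : b (s • (siteToE x + centreOffset q) - y) = 0
  · simp only [hw, zero_mul]
  · rw [dependsOn_plane r q (base_nonneg_of_weight_ne_zero hbpos hs q hy hw) hUV]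

omit [BorelSpace G] in
/-- **The mirror of an atom**: for a profile time-symmetric about `t/2` and a valid
orientation, `F_y ∘ Θ_cfg = F_{y_m}` with `y_m = mirrorOffset t y` (plane reflection law + plaquette-centre smearing). [folklore] -/
theorem atom_comp_cfgReflect (r : LatticeRep G) {b : EuclideanSpace ℝ (Fin 4) → ℝ} (t : ℝ)
    (hsym : ∀ u : EuclideanSpace ℝ (Fin 4), b (WithLp.toLp 2 fun i => if i = 0 then t - u i else u i) = b u)
    {q : Fin 4 × Fin 4} (hq : q.1 < q.2) (s : ℝ) (y : EuclideanSpace ℝ (Fin 4)) (U : LGConfig 4 G) :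
    (∑' x : Fin 4 → ℤ, b (s • (siteToE x + centreOffset q) - y) * plane G r q x (cfgReflect U)) =
      ∑' x : Fin 4 → ℤ, b (s • (siteToE x + centreOffset q) - mirrorOffset t y) * plane G r q x U := by
  -- re-index the left-hand side by the involution `x ↦ reflSite q x`
  have hinv : Function.Involutive (reflSite q) := fun x => reflSite_reflSite q x
  rw [← Equiv.tsum_eq (hinv.toPerm _)]
  refine tsum_congr fun x => ?_
  have hρ : hinv.toPerm _ x = reflSite q x := rfl
  rw [hρ, plane_cfgReflect r hq, reflSite_reflSite,
    smul_reflSite_add_of_centre s q x _ (two_mul_centreOffset_zero hq), mirror_weight b t hsym]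

omit [BorelSpace G] in
/-- **Uniform bound on atoms of spacing `≥ s₀`**: `|F| ≤ (⌈R₀/s₀⌉₊ + 1)⁴ · M_b · N`. [folklore] -/
theorem abs_atom_le (r : LatticeRep G) {b : EuclideanSpace ℝ (Fin 4) → ℝ} {R₀ Mb : ℝ} (hR₀ : 0 ≤ R₀)
    (hbR : tsupport b ⊆ {u : EuclideanSpace ℝ (Fin 4) | ∀ j, 0 ≤ u j ∧ u j ≤ R₀}) (hMb : ∀ u, |b u| ≤ Mb)
    {s₀ s : ℝ} (hs₀ : 0 < s₀) (hs : s₀ ≤ s) (q : Fin 4 × Fin 4) (y : EuclideanSpace ℝ (Fin 4)) (U : LGConfig 4 G) :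
    |∑' x : Fin 4 → ℤ, b (s • (siteToE x + centreOffset q) - y) * plane G r q x U| ≤
      ((⌈R₀ / s₀⌉₊ + 1 : ℕ) : ℝ) ^ 4 * Mb * r.N := by
  have hs' : 0 < s := hs₀.trans_le hs
  refine (abs_bumpAtom_le G r b hbR hs' q y U).trans ?_
  have hMb0 : 0 ≤ Mb := (abs_nonneg _).trans (hMb 0)
  have hcard : ((atomSites R₀ s y).card : ℝ) ≤ ((⌈R₀ / s₀⌉₊ + 1 : ℕ) : ℝ) ^ 4 := by
    have h1 : (atomSites R₀ s y).card = (⌈R₀ / s⌉₊ + 1) ^ 4 := by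
      rw [atomSites, Fintype.card_piFinset]
      have hx : ∀ x : Fin 4, (Finset.Icc ⌊y x / s⌋ (⌊y x / s⌋ + ⌈R₀ / s⌉₊)).card = ⌈R₀ / s⌉₊ + 1 := fun x => by
        rw [Int.card_Icc]; omega
      simp only [hx, Finset.prod_const, Finset.card_univ, Fintype.card_fin]
    have h2 : ⌈R₀ / s⌉₊ ≤ ⌈R₀ / s₀⌉₊ := Nat.ceil_le_ceil (div_le_div_of_nonneg_left hR₀ hs₀ hs)
    rw [h1]
    exact_mod_cast Nat.pow_le_pow_left (by omega) 4
  have hsum : ∑ x ∈ atomSites R₀ s y, |b (s • (siteToE x + centreOffset q) - y)| ≤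
      ((⌈R₀ / s₀⌉₊ + 1 : ℕ) : ℝ) ^ 4 * Mb := by
    refine (Finset.sum_le_card_nsmul _ _ Mb fun x _ => hMb _).trans ?_
    rw [nsmul_eq_mul]
    exact mul_le_mul_of_nonneg_right hcard hMb0
  exact mul_le_mul_of_nonneg_right hsum (Nat.cast_nonneg _)

omit [TopologicalSpace G] [IsTopologicalGroup G] [CompactSpace G] [BorelSpace G] in
/-- Covariances of observables bounded by `B` are bounded by `4B²`. [folklore] -/
theorem abs_covariance_le {μ : Measure (LGConfig 4 G)} [IsProbabilityMeasure μ] {X Y : LGConfig 4 G → ℝ} {B : ℝ}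
    (hX : ∀ U, |X U| ≤ B) (hY : ∀ U, |Y U| ≤ B) : |cov[X, Y; μ]| ≤ 4 * B ^ 2 := by
  have hB : 0 ≤ B := (abs_nonneg _).trans (hX (Classical.arbitrary _))
  have hmX : |∫ U, X U ∂μ| ≤ B := by
    have h := norm_integral_le_of_norm_le_const (μ := μ) (f := X) (C := B)
      (Eventually.of_forall fun U => by rw [Real.norm_eq_abs]; exact hX U)
    rwa [Real.norm_eq_abs, probReal_univ, mul_one] at h
  have hmY : |∫ U, Y U ∂μ| ≤ B := by
    have h := norm_integral_le_of_norm_le_const (μ := μ) (f := Y) (C := B)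
      (Eventually.of_forall fun U => by rw [Real.norm_eq_abs]; exact hY U)
    rwa [Real.norm_eq_abs, probReal_univ, mul_one] at h
  unfold covariance
  have h := norm_integral_le_of_norm_le_const (μ := μ)
    (f := fun U => (X U - ∫ V, X V ∂μ) * (Y U - ∫ V, Y V ∂μ)) (C := (2 * B) * (2 * B))
    (Eventually.of_forall fun U => by
      rw [Real.norm_eq_abs, abs_mul]
      have h1 : |X U - ∫ V, X V ∂μ| ≤ 2 * B := (abs_sub _ _).trans (by linarith [hX U])
      have h2 : |Y U - ∫ V, Y V ∂μ| ≤ 2 * B := (abs_sub _ _).trans (by linarith [hY U])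
      exact mul_le_mul h1 h2 (abs_nonneg _) (by linarith [abs_nonneg (X U - ∫ V, X V ∂μ)]))
  rw [Real.norm_eq_abs, probReal_univ, mul_one] at h
  linarith

omit [TopologicalSpace G] [IsTopologicalGroup G] [CompactSpace G] [BorelSpace G] in
/-- **Real reflection positivity on the positive-time cone** of a torus limit state, for `Θ_cfg`: from GaugeBoot's complex
site-RP `IsReflectionPositiveFor (configSiteReflect 0) (siteHalfEdges 0) μ`. [folklore] -/
theorem rp_real {μ : Measure (LGConfig 4 G)}
    (hRP : IsReflectionPositiveFor (configSiteReflect (G := G) 0) (siteHalfEdges 0) μ)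
    (H : LGConfig 4 G → ℝ) (hH : Measurable H) (hb : ∃ C : ℝ, ∀ U, |H U| ≤ C)
    (hD : DependsOn H (siteHalfEdges (d := 4) 0)) : 0 ≤ ∫ U, H (cfgReflect U) * H U ∂μ := by
  obtain ⟨C, hC⟩ := hb
  have hpos := hRP (fun U => ((H U : ℝ) : ℂ)) (Complex.measurable_ofReal.comp hH)
    ⟨C, fun U => by rw [Complex.norm_real, Real.norm_eq_abs]; exact hC U⟩ (fun U V hUV => by simp only [hD hUV])
  simp only [configSiteReflect_zero_eq_cfgReflect, Complex.conj_ofReal, ← Complex.ofReal_mul,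
    integral_complex_ofReal, Complex.zero_le_real] at hpos
  exact hpos

end Atoms

end Summit.QuantumFields.YangMills.Theorems.RPOnsetFloorCoarseCollar

end
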